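import Summits.CriticalPhenomena.PercolationContinuityZ3.Theorems.PercNearOneGluingNoHeavyLowerTailCILReduction
import Summits.CriticalPhenomena.PercolationContinuityZ3.Theorems.PercNearOneGluingNoHeavyLowerTailLightnessDiamond
import Summits.CriticalPhenomena.PercolationContinuityZ3.Theorems.PercNearOneGluingNearOneGluingExchS1
import HarnessLib

/-!
# `NoHeavyLowerTail` (stmt-CriticalPhenomena-4575) — the UPWARD-TRANSPORT form `UT` of the champion comparison
# closes the crux (typed reduction)

Lemma factory #6 (`prim-lf-6`, gen 2, observer-set technique), 2026-08-19.  `μ = prodBernoulli w` on `Fin n`, relays `A`,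
observer `o ∉ A`, level `j`, `π(v) = {x ∈ A : v ↔ x}`, `N_v = |π(v)|`, champion `c ∈ A` (`μ(N_a ≤ j) ≤ μ(N_c ≤ j)` for all
`a ∈ A`), and `C_o` = the open EDGE cluster of `o` (van den Berg–Häggström–Kahn; tree `openEdgeCluster`).

**UT** (memo `run/shared/lean/prim/prim-lf-6/CANDIDATES.md` §B3.1; ttrl2 request `lf6-ut-monotone-coupling`):
for every up-set `𝒰` of edge sets,

  `μ(C_o ∈ 𝒰, o ↮ c, N_o ≥ 1, N_c > j) ≤ μ(C_o ∈ 𝒰, o ↮ c, N_o > j)`.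

By Strassen's theorem this is the statement that the mass of "light pockets of `o` seen while the champion is heavy" is
transported UPWARD in the cluster lattice (`W ↦ W' ⊋ W`), mass-dominated, onto "heavy pockets of `o` seen while the champion
is light" — a monotone coupling.  Census: 0 violations in ≈ 4 500 exact max-flow instances (`n ≤ 8`, `k ≤ 6`, all `j`,
four weight families, incl. 1 030 instances with pair pockets in the cells `(5,2)`, `(6,2)`); the singleton-pocket part is a
theorem (lonely-observer packing); `𝒰` inside `{o ↔ x}` for one relay `x` is a theorem (BHK 2006 Thm 1.5 exchange).

THIS FILE (no definitions, no named facts, no sorries): the instance `𝒰 = univ` of UT is the guarded Cauchy–Schwarz / T-form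
inequality `μ(o ↮ c, N_o ≥ 1, N_c > j) ≤ μ(o ↮ c, N_o > j)`, which gives the cumulative isolation lemma with the champion as
witness (`UpwardTransport.cil_of_tform`); hence UT ⟹ `stub_cumulativeIsolation` ⟹ `NoHeavyLowerTail`
(`noHeavyLowerTail_of_upwardTransport`), so that UT is a typed `exact` target of the crux.

Appended (same seat): `UpwardTransport.upset_within_relay` — the face of UT inside one relay's territory
(`𝒰 ∩ {o ↔ x}`, `x ≠ c`, `μ(N_x ≤ j) ≤ μ(N_c ≤ j)`) is a THEOREM, by the lonely-cluster exchange
(`lonelyClusterExchange_typeMinus`, BHK 2006 Thm 1.5).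
-/

noncomputable section

namespace Summit.CriticalPhenomena.PercolationContinuityZ3.Theorems

open MeasureTheory Set Literature.Probability.LatticeModels Literature.Probability.Percolation
open scoped Classical BigOperators
open LightnessDiamond

namespace UpwardTransport

variable {n : ℕ}

/-- **T-form at one designee ⟹ CIL with that designee.**  If
`μ(o ↮ c, N_o ≥ 1, N_c > j) ≤ μ(o ↮ c, N_o > j)` then `μ(1 ≤ N_o ≤ j) ≤ μ(N_c ≤ j)`:
on `{o ↔ c}` the two relay sets coincide, and on `{o ↮ c}` one has
`μ(1 ≤ N_o ≤ j, o ↮ c) = μ(N_o ≥ 1, o ↮ c) − μ(N_o > j, o ↮ c) ≤ μ(N_o ≥ 1, N_c ≤ j, o ↮ c)`. [this file] -/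
theorem cil_of_tform (w : Sym2 (Fin n) → unitInterval) (A : Finset (Fin n)) (o c : Fin n) (j : ℕ)
    (hT : (prodBernoulli w).real ({ω : BondConfig (Fin n) | ω ∉ openConn o c} ∩
        {ω | 1 ≤ (A.filter fun z => ω ∈ openConn o z).card} ∩
        {ω | j < (A.filter fun z => ω ∈ openConn c z).card}) ≤
      (prodBernoulli w).real ({ω : BondConfig (Fin n) | ω ∉ openConn o c} ∩
        {ω | j < (A.filter fun z => ω ∈ openConn o z).card})) :
    (prodBernoulli w).real {ω : BondConfig (Fin n) |
        1 ≤ (A.filter fun z => ω ∈ openConn o z).card ∧ (A.filter fun z => ω ∈ openConn o z).card ≤ j} ≤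
      (prodBernoulli w).real {ω : BondConfig (Fin n) | (A.filter fun z => ω ∈ openConn c z).card ≤ j} := by
  set μ := prodBernoulli w with hμ
  set No : BondConfig (Fin n) → ℕ := fun ω => (A.filter fun z => ω ∈ openConn o z).card with hNo
  set Nc : BondConfig (Fin n) → ℕ := fun ω => (A.filter fun z => ω ∈ openConn c z).card with hNc
  set D : Set (BondConfig (Fin n)) := {ω | ω ∉ openConn o c} with hD
  set L : Set (BondConfig (Fin n)) := {ω | 1 ≤ No ω ∧ No ω ≤ j} with hL
  set Rc : Set (BondConfig (Fin n)) := {ω | Nc ω ≤ j} with hRc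
  -- split `L` and `Rc` along `{o ↔ c}`
  have hLsplit : μ.real L = μ.real (L ∩ D) + μ.real (L \ D) :=
    (measureReal_inter_add_sdiff₀ (s := L) MeasurableSet.of_discrete.nullMeasurableSet).symm
  have hRsplit : μ.real Rc = μ.real (Rc ∩ D) + μ.real (Rc \ D) :=
    (measureReal_inter_add_sdiff₀ (s := Rc) MeasurableSet.of_discrete.nullMeasurableSet).symm
  -- on `{o ↔ c}`: `π(o) = π(c)`, so `L \ D ⊆ Rc \ D`
  have h1 : μ.real (L \ D) ≤ μ.real (Rc \ D) := by
    refine measureReal_mono (fun ω hω => ?_) (measure_ne_top _ _)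
    obtain ⟨⟨_, hle⟩, hnD⟩ := hω
    have hoc : ω ∈ (openConn o c : Set (BondConfig (Fin n))) := by
      by_contra h; exact hnD h
    refine ⟨?_, hnD⟩
    show Nc ω ≤ j
    have := filter_eq_of_openConn A o c hoc
    simp only [hNc]; rw [← this]; exact hle
  -- on `{o ↮ c}`: `L ∩ D = (D ∩ {1 ≤ N_o}) \ (D ∩ {j < N_o})`
  set E1 : Set (BondConfig (Fin n)) := D ∩ {ω | 1 ≤ No ω} with hE1
  set E2 : Set (BondConfig (Fin n)) := D ∩ {ω | j < No ω} with hE2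
  have hE2sub : E2 ⊆ E1 := fun ω hω => ⟨hω.1, le_trans (Nat.succ_le_succ (Nat.zero_le j)) hω.2⟩
  have hLD : L ∩ D = E1 \ E2 := by
    ext ω
    simp only [hL, hE1, hE2, mem_inter_iff, mem_setOf_eq, mem_sdiff, not_and, not_lt]
    constructor
    · rintro ⟨⟨h1', h2'⟩, hd⟩; exact ⟨⟨hd, h1'⟩, fun _ => h2'⟩
    · rintro ⟨⟨hd, h1'⟩, h2'⟩; exact ⟨⟨h1', h2' hd⟩, hd⟩
  have h2 : μ.real (L ∩ D) = μ.real E1 - μ.real E2 := by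
    rw [hLD, measureReal_sdiff hE2sub MeasurableSet.of_discrete]
  -- `E1 = (E1 ∩ {j < N_c}) ⊔ (E1 ∩ {N_c ≤ j})`
  have hE1split : μ.real E1 = μ.real (E1 ∩ {ω | j < Nc ω}) + μ.real (E1 \ {ω | j < Nc ω}) :=
    (measureReal_inter_add_sdiff₀ (s := E1) MeasurableSet.of_discrete.nullMeasurableSet).symm
  -- the T-form hypothesis, rewritten
  have hT' : μ.real (E1 ∩ {ω | j < Nc ω}) ≤ μ.real E2 := by
    have e : E1 ∩ {ω | j < Nc ω} = D ∩ {ω | 1 ≤ No ω} ∩ {ω | j < Nc ω} := rfl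
    rw [e]; exact hT
  -- `E1 \ {j < N_c} ⊆ Rc ∩ D`
  have h3 : μ.real (E1 \ {ω | j < Nc ω}) ≤ μ.real (Rc ∩ D) := by
    refine measureReal_mono (fun ω hω => ?_) (measure_ne_top _ _)
    obtain ⟨⟨hd, _⟩, hn⟩ := hω
    have hn' : Nc ω ≤ j := not_lt.1 hn
    exact ⟨hn', hd⟩
  calc μ.real L = μ.real (L ∩ D) + μ.real (L \ D) := hLsplit
    _ ≤ μ.real (Rc ∩ D) + μ.real (Rc \ D) := by rw [h2]; linarith
    _ = μ.real Rc := hRsplit.symm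

end UpwardTransport

open UpwardTransport in
/-- **UT closes the crux.**  If for every weighted graph, every relay set `A`, every observer `o ∉ A`, every level `j`,
every champion `c ∈ A` at level `j` and EVERY up-set `𝒰` of edge sets,
`μ(C_o ∈ 𝒰, o ↮ c, N_o ≥ 1, N_c > j) ≤ μ(C_o ∈ 𝒰, o ↮ c, N_o > j)` (`C_o = openEdgeCluster ω o`), then
`NoHeavyLowerTail` holds: the instance `𝒰 = univ` is the T-form inequality at the champion, which gives the
cumulative isolation lemma (`cil_of_tform`), which closes the crux (`noHeavyLowerTail_of_stub_cumulativeIsolation`).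
[this file] -/
theorem noHeavyLowerTail_of_upwardTransport
    (hUT : ∀ (n : ℕ) (w : Sym2 (Fin n) → unitInterval) (A : Finset (Fin n)) (o c : Fin n) (j : ℕ)
      (U : Set (Set (Sym2 (Fin n)))), o ∉ A → c ∈ A →
      (∀ a ∈ A, (Literature.Probability.LatticeModels.prodBernoulli w).real
          {ω : Literature.Probability.Percolation.BondConfig (Fin n) |
            (A.filter fun z => ω ∈ Literature.Probability.Percolation.openConn a z).card ≤ j} ≤
        (Literature.Probability.LatticeModels.prodBernoulli w).real
          {ω : Literature.Probability.Percolation.BondConfig (Fin n) |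
            (A.filter fun z => ω ∈ Literature.Probability.Percolation.openConn c z).card ≤ j}) →
      IsUpperSet U →
      (Literature.Probability.LatticeModels.prodBernoulli w).real
          ({ω : Literature.Probability.Percolation.BondConfig (Fin n) |
              Literature.Probability.Percolation.openEdgeCluster ω o ∈ U} ∩
            {ω | ω ∉ Literature.Probability.Percolation.openConn o c} ∩
            {ω | 1 ≤ (A.filter fun z => ω ∈ Literature.Probability.Percolation.openConn o z).card} ∩
            {ω | j < (A.filter fun z => ω ∈ Literature.Probability.Percolation.openConn c z).card}) ≤
        (Literature.Probability.LatticeModels.prodBernoulli w).real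
          ({ω : Literature.Probability.Percolation.BondConfig (Fin n) |
              Literature.Probability.Percolation.openEdgeCluster ω o ∈ U} ∩
            {ω | ω ∉ Literature.Probability.Percolation.openConn o c} ∩
            {ω | j < (A.filter fun z => ω ∈ Literature.Probability.Percolation.openConn o z).card})) :
    Summit.CriticalPhenomena.PercolationContinuityZ3.Theses.PercNearOneGluing.NoHeavyLowerTail := by
  refine noHeavyLowerTail_of_stub_cumulativeIsolation fun n w A o j hA ho => ?_
  -- the champion at level `j`
  obtain ⟨c, hc, hmax⟩ := Finset.exists_max_image A
    (fun a => (prodBernoulli w).real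
      {ω : BondConfig (Fin n) | (A.filter fun z => ω ∈ openConn a z).card ≤ j}) hA
  refine ⟨c, hc, ?_⟩
  have hU : IsUpperSet (Set.univ : Set (Set (Sym2 (Fin n)))) := isUpperSet_univ
  have key := hUT n w A o c j Set.univ ho hc (fun a ha => hmax a ha) hU
  simp only [Set.mem_univ, Set.setOf_true, Set.univ_inter] at key
  exact cil_of_tform w A o c j key

namespace UpwardTransport

variable {n : ℕ}

/-- **UT inside one relay's territory is a theorem** (the BHK 2006 Thm 1.5 exchange face of UT).  For a relay
`x ≠ c` with `μ(N_x ≤ j) ≤ μ(N_c ≤ j)` (e.g. `c` a champion) and ANY up-set `𝒰` of edge sets: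
`μ(C_o ∈ 𝒰, o ↔ x, o ↮ c, N_c > j) ≤ μ(C_o ∈ 𝒰, o ↔ x, o ↮ c, N_o > j)`.
Proof: on `{o ↔ x}` one has `C_o = C_x`, `N_o = N_x` and `{o ↮ c} = {x ↮ c}`; the event
`B = {C_o ∈ 𝒰} ∩ {o ↔ x}` is closed under enlarging `C_x` and shrinking `C_c`, so the lonely-cluster exchange
(`lonelyClusterExchange_typeMinus` with `s = c`, `t = x`) and `μ(x ↮ c, N_x ≤ j) ≤ μ(x ↮ c, N_c ≤ j)` give
`μ(x ↮ c, B, N_x ≤ j) ≤ μ(x ↮ c, B, N_c ≤ j)`, which is the claim after complementing inside `{x ↮ c} ∩ B`.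
[this file; cite: VandenbergHaggstromKahn2005, Thm. 1.5 (p. 7) via `lonelyClusterExchange_typeMinus`] -/
theorem upset_within_relay (w : Sym2 (Fin n) → unitInterval) (A : Finset (Fin n)) (o x c : Fin n) (j : ℕ)
    (U : Set (Set (Sym2 (Fin n)))) (hU : IsUpperSet U) (hxc : x ≠ c)
    (hle : (prodBernoulli w).real {ω : BondConfig (Fin n) | (A.filter fun z => ω ∈ openConn x z).card ≤ j} ≤
      (prodBernoulli w).real {ω : BondConfig (Fin n) | (A.filter fun z => ω ∈ openConn c z).card ≤ j}) :
    (prodBernoulli w).real ({ω : BondConfig (Fin n) | openEdgeCluster ω o ∈ U} ∩ openConn o x ∩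
        {ω | ω ∉ openConn o c} ∩ {ω | j < (A.filter fun z => ω ∈ openConn c z).card}) ≤
      (prodBernoulli w).real ({ω : BondConfig (Fin n) | openEdgeCluster ω o ∈ U} ∩ openConn o x ∩
        {ω | ω ∉ openConn o c} ∩ {ω | j < (A.filter fun z => ω ∈ openConn o z).card}) := by
  set μ := prodBernoulli w with hμ
  set Rx : Set (BondConfig (Fin n)) := {ω | (A.filter fun z => ω ∈ openConn x z).card ≤ j} with hRx
  set Rc : Set (BondConfig (Fin n)) := {ω | (A.filter fun z => ω ∈ openConn c z).card ≤ j} with hRc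
  set D : Set (BondConfig (Fin n)) := (openConn c x)ᶜ with hD
  set B : Set (BondConfig (Fin n)) := {ω : BondConfig (Fin n) | openEdgeCluster ω o ∈ U} ∩ openConn o x
    with hB
  have hmeas : ∀ S : Set (BondConfig (Fin n)), MeasurableSet S := fun _ => MeasurableSet.of_discrete
  -- `B` is of type `(−)` for the pair `(c, x)`: closed under shrinking `C_c` and enlarging `C_x`
  have hBtype : ∀ ⦃ω ω' : BondConfig (Fin n)⦄, openEdgeCluster ω' c ⊆ openEdgeCluster ω c →
      openEdgeCluster ω x ⊆ openEdgeCluster ω' x → ω ∈ B → ω' ∈ B := by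
    intro ω ω' _ hx hω
    obtain ⟨hωU, hox⟩ := hω
    have hox' : ω ∈ (openConn o x : Set (BondConfig (Fin n))) := hox
    have heq : openEdgeCluster ω o = openEdgeCluster ω x := exS1_openEdgeCluster_eq_of_conn hox'
    -- `o ↔ x` in `ω'`: `o` lies on an edge of `C_x(ω) ⊆ C_x(ω')` (note `o ≠ x` is not needed: use reachability)
    have hxo : (openGraph ω).Reachable x o := (hox' : (openGraph ω).Reachable o x).symm
    have hxo' : (openGraph ω').Reachable x o := by
      rcases (reachable_iff_exists_mem_openEdgeCluster ω x o).1 hxo with h0 | ⟨e, he, hoe⟩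
      · exact h0 ▸ SimpleGraph.Reachable.refl _
      · exact (reachable_iff_exists_mem_openEdgeCluster ω' x o).2 (Or.inr ⟨e, hx he, hoe⟩)
    have hox'' : ω' ∈ (openConn o x : Set (BondConfig (Fin n))) := hxo'.symm
    refine ⟨?_, hox''⟩
    show openEdgeCluster ω' o ∈ U
    rw [exS1_openEdgeCluster_eq_of_conn hox'']
    exact hU (heq ▸ hx : openEdgeCluster ω o ⊆ openEdgeCluster ω' x) hωU
  -- the exchange
  have hex : μ.real (D ∩ (Rx ∩ B)) * μ.real (D ∩ Rc) ≤ μ.real (D ∩ Rx) * μ.real (D ∩ (B ∩ Rc)) :=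
    lonelyClusterExchange_typeMinus w (Ne.symm hxc) A j hBtype
  -- `μ(D ∩ R_x) ≤ μ(D ∩ R_c)` from `hle` (off `D` the two events coincide)
  have hoff : Rx \ D = Rc \ D := by
    ext ω
    simp only [hRx, hRc, hD, mem_sdiff, mem_compl_iff, not_not, mem_setOf_eq]
    constructor
    · rintro ⟨h, hcx⟩; exact ⟨by rw [filter_eq_of_openConn A c x hcx]; exact h, hcx⟩
    · rintro ⟨h, hcx⟩; exact ⟨by rw [← filter_eq_of_openConn A c x hcx]; exact h, hcx⟩
  have hDle : μ.real (D ∩ Rx) ≤ μ.real (D ∩ Rc) := by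
    have e1 := measureReal_inter_add_sdiff₀ (μ := μ) (s := Rx) (t := D) (hmeas D).nullMeasurableSet
    have e2 := measureReal_inter_add_sdiff₀ (μ := μ) (s := Rc) (t := D) (hmeas D).nullMeasurableSet
    rw [inter_comm] at e1 e2
    rw [hoff] at e1
    linarith
  -- hence `μ(D ∩ B ∩ R_x) ≤ μ(D ∩ B ∩ R_c)`
  have hkey : μ.real (D ∩ (Rx ∩ B)) ≤ μ.real (D ∩ (B ∩ Rc)) := by
    rcases (measureReal_nonneg : 0 ≤ μ.real (D ∩ Rc)).eq_or_lt with h0 | hpos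
    · have h1 : μ.real (D ∩ Rx) = 0 := le_antisymm (h0 ▸ hDle) measureReal_nonneg
      have h2 : μ.real (D ∩ (Rx ∩ B)) ≤ μ.real (D ∩ Rx) :=
        measureReal_mono (fun ω hω => ⟨hω.1, hω.2.1⟩) (measure_ne_top _ _)
      linarith [measureReal_nonneg (μ := μ) (s := D ∩ (B ∩ Rc)), measureReal_nonneg (μ := μ) (s := D ∩ (Rx ∩ B))]
    · have h3 : μ.real (D ∩ (Rx ∩ B)) * μ.real (D ∩ Rc) ≤ μ.real (D ∩ (B ∩ Rc)) * μ.real (D ∩ Rc) := by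
        calc μ.real (D ∩ (Rx ∩ B)) * μ.real (D ∩ Rc) ≤ μ.real (D ∩ Rx) * μ.real (D ∩ (B ∩ Rc)) := hex
          _ ≤ μ.real (D ∩ Rc) * μ.real (D ∩ (B ∩ Rc)) :=
              mul_le_mul_of_nonneg_right hDle measureReal_nonneg
          _ = μ.real (D ∩ (B ∩ Rc)) * μ.real (D ∩ Rc) := mul_comm _ _
      exact le_of_mul_le_mul_right h3 hpos
  -- complement inside `D ∩ B`
  have hsplitx := measureReal_inter_add_sdiff₀ (μ := μ) (s := D ∩ B) (t := Rx) (hmeas Rx).nullMeasurableSet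
  have hsplitc := measureReal_inter_add_sdiff₀ (μ := μ) (s := D ∩ B) (t := Rc) (hmeas Rc).nullMeasurableSet
  have e1 : D ∩ B ∩ Rx = D ∩ (Rx ∩ B) := by ext ω; simp only [mem_inter_iff]; tauto
  have e2 : D ∩ B ∩ Rc = D ∩ (B ∩ Rc) := by ext ω; simp only [mem_inter_iff]; tauto
  rw [e1] at hsplitx; rw [e2] at hsplitc
  have hcompl : μ.real ((D ∩ B) \ Rc) ≤ μ.real ((D ∩ B) \ Rx) := by linarith
  -- identify the two events of the statement
  have hL : {ω : BondConfig (Fin n) | openEdgeCluster ω o ∈ U} ∩ openConn o x ∩ {ω | ω ∉ openConn o c} ∩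
      {ω | j < (A.filter fun z => ω ∈ openConn c z).card} = (D ∩ B) \ Rc := by
    ext ω
    simp only [hB, hD, hRc, mem_inter_iff, mem_setOf_eq, mem_sdiff, mem_compl_iff, not_le]
    constructor
    · rintro ⟨⟨⟨hU', hox⟩, hoc⟩, hj⟩
      refine ⟨⟨fun hcx => hoc ?_, hU', hox⟩, hj⟩
      have h1 : (openGraph ω).Reachable o x := hox
      have h2 : (openGraph ω).Reachable c x := hcx
      exact h1.trans h2.symm
    · rintro ⟨⟨hcx, hU', hox⟩, hj⟩
      refine ⟨⟨⟨hU', hox⟩, fun hoc => hcx ?_⟩, hj⟩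
      have h1 : (openGraph ω).Reachable o x := hox
      have h2 : (openGraph ω).Reachable o c := hoc
      exact h2.symm.trans h1
  have hR : {ω : BondConfig (Fin n) | openEdgeCluster ω o ∈ U} ∩ openConn o x ∩ {ω | ω ∉ openConn o c} ∩
      {ω | j < (A.filter fun z => ω ∈ openConn o z).card} = (D ∩ B) \ Rx := by
    ext ω
    simp only [hB, hD, hRx, mem_inter_iff, mem_setOf_eq, mem_sdiff, mem_compl_iff, not_le]
    constructor
    · rintro ⟨⟨⟨hU', hox⟩, hoc⟩, hj⟩
      refine ⟨⟨fun hcx => hoc ?_, hU', hox⟩, ?_⟩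
      · have h1 : (openGraph ω).Reachable o x := hox
        have h2 : (openGraph ω).Reachable c x := hcx
        exact h1.trans h2.symm
      · rw [← filter_eq_of_openConn A o x hox]; exact hj
    · rintro ⟨⟨hcx, hU', hox⟩, hj⟩
      refine ⟨⟨⟨hU', hox⟩, fun hoc => hcx ?_⟩, ?_⟩
      · have h1 : (openGraph ω).Reachable o x := hox
        have h2 : (openGraph ω).Reachable o c := hoc
        exact h2.symm.trans h1
      · rw [filter_eq_of_openConn A o x hox]; exact hj
  rw [hL, hR]
  exact hcompl

end UpwardTransport

end Summit.CriticalPhenomena.PercolationContinuityZ3.Theorems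

end
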